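import Literature.AlgebraicGeometry.Frobenioids.CategoriesFactorization
import HarnessLib

/-!
# Frobenioids I, §0: categories of FSMFF-type — the author's revised condition (b) (Comments, 2024)

Mochizuki, *The geometry of Frobenioids I: the general theory*, Kyushu J. Math. **62** (2008)
293–400, §0 "Categories", kurims text pp. 17–18 [cite: MochizukiFrdI2008, §0 p.17], together
with the author's *Comments on "The geometry of Frobenioids I"* (January 2024), item (28), p. 3
[cite: MochizukiFrdIComments2024, (28) p.3]:

> "(28.) In §0, condition (b) of the definition of a category of FSMFF-type should read as
> follows: for every `A ∈ Ob(C)`, there exists a natural number `N` such that for every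
> composite `φₙ ∘ φₙ₋₁ ∘ ⋯ ∘ φ₂ ∘ φ₁` of some morphism `φ₁` whose domain is equal to `A` with
> FSMI-morphisms `φ₂, …, φₙ`, it holds that `n ≤ N`."

The landed `CategoriesFactorization.lean` types the ORIGINAL (2008) printed condition (b) — chains
`φₙ ∘ ⋯ ∘ φ₁` of FSMI-morphisms `φ₁, …, φₙ` out of `A` have bounded length — as the field
`IsOfFSMFFType.bounded`. The 2024 text lets the FIRST arrow `φ₁ : A → X` be ARBITRARY and asks for
a bound, uniform in `φ₁`, on the chains of FSMI-morphisms continuing it; this is a strictly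
stronger requirement (it bounds the FSMI-chains out of every `X` that receives an arrow from `A`,
uniformly in `X`), and it is the form used by the author's corrected statement and proof of
Prop. 1.14 (iii) (same item (28), pp. 3–4; typed and proved in
`IrreducibleMorphismsRevised.lean`) and by the corrected proof of [FrdII] Prop. 3.4 (viii).

This file is ADDITIVE: it introduces the chain predicate `IsHeadedFSMIChain P φ n` ("`φ` is a
composite of `n` arrows whose first member lies in the class `P` and whose remaining `n - 1`
members are FSMI-morphisms") and the revised notion `IsOfFSMFFType2024` (condition (a) verbatim
as in 2008, condition (b) as in the 2024 comments), and records the formal comparisons: the 2024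
notion implies the 2008 one; a category of FSM-type is of FSMFF-type in the 2024 sense ("Thus, if
`C` is of FSM-type, then it is of FSMFF-type", p. 18, survives the revision with `N = 1`); no
endomorphism in a category of FSMFF-type (2024) is an FSMI-morphism (p. 18). The 2008 structure
`IsOfFSMFFType` is left untouched as the record of the printed original. Everything is PROVED;
nothing here is specific to Frobenioids.
-/

namespace Literature.AlgebraicGeometry.Frobenioids

open CategoryTheory

universe v u

variable {C : Type u} [Category.{v} C]

/-! ### Chains with a prescribed head and an FSMI tail -/

/-- `IsHeadedFSMIChain P φ n`: `φ` is a composite `φₙ ∘ ⋯ ∘ φ₂ ∘ φ₁` (diagrammatic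
`φ₁ ≫ (φ₂ ≫ ⋯ ≫ φₙ)`) of `n ≥ 1` arrows of which the FIRST, `φ₁`, lies in the class `P` and the
remaining `φ₂, …, φₙ` are FSMI-morphisms — the shape of composite quantified over in the author's
revised condition (b) of "FSMFF-type" (`P = ⊤`: "some morphism `φ₁` whose domain is equal to `A`
with FSMI-morphisms `φ₂, …, φₙ`") and in the revised Prop. 1.14 (iii) (`P` = irreducible).
[cite: MochizukiFrdIComments2024, (28) p.3] -/
inductive IsHeadedFSMIChain (P : MorphismProperty C) : ∀ {A B : C}, (A ⟶ B) → ℕ → Prop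
  /-- a single arrow of `P` is a chain of length one -/
  | single {A B : C} (φ : A ⟶ B) : P φ → IsHeadedFSMIChain P φ 1
  /-- an arrow of `P` followed by a chain of `m` FSMI-morphisms is a chain of length `m + 1` -/
  | comp {A X B : C} (φ₁ : A ⟶ X) (χ : X ⟶ B) (m : ℕ) :
      P φ₁ → IsFSMIChain χ m → IsHeadedFSMIChain P (φ₁ ≫ χ) (m + 1)

namespace IsHeadedFSMIChain

variable {P Q : MorphismProperty C}

/-- Chains have positive length. [cite: MochizukiFrdIComments2024, (28) p.3] -/
theorem pos {A B : C} {φ : A ⟶ B} {n : ℕ} (h : IsHeadedFSMIChain P φ n) : 0 < n := by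
  cases h with
  | single _ _ => exact Nat.one_pos
  | comp _ _ m _ _ => exact Nat.succ_pos m

/-- Monotonicity in the class of admissible heads. [cite: MochizukiFrdIComments2024, (28) p.3] -/
theorem of_le (hPQ : ∀ {X Y : C} (f : X ⟶ Y), P f → Q f) {A B : C} {φ : A ⟶ B} {n : ℕ}
    (h : IsHeadedFSMIChain P φ n) : IsHeadedFSMIChain Q φ n := by
  cases h with
  | single φ hφ => exact single φ (hPQ φ hφ)
  | comp φ₁ χ m hφ₁ hχ => exact comp φ₁ χ m (hPQ φ₁ hφ₁) hχ

/-- Every headed chain is a chain with arbitrary head (`P = ⊤`), the shape of the revised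
condition (b). [cite: MochizukiFrdIComments2024, (28) p.3] -/
theorem top {A B : C} {φ : A ⟶ B} {n : ℕ} (h : IsHeadedFSMIChain P φ n) :
    IsHeadedFSMIChain ⊤ φ n :=
  h.of_le fun f _ => MorphismProperty.top_apply f

/-- The head of a chain: `φ = φ₁ ≫ χ` with `φ₁ ∈ P` and `χ` an identity (`n = 1`) or a composite
of `n - 1` FSMI-morphisms. [cite: MochizukiFrdIComments2024, (28) p.3] -/
theorem exists_fac {A B : C} {φ : A ⟶ B} {n : ℕ} (h : IsHeadedFSMIChain P φ n) :
    ∃ (X : C) (φ₁ : A ⟶ X) (χ : X ⟶ B), P φ₁ ∧ φ₁ ≫ χ = φ ∧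
      ((n = 1 ∧ IsIso χ) ∨ ∃ m, n = m + 1 ∧ IsFSMIChain χ m) := by
  cases h with
  | single φ hφ => exact ⟨B, φ, 𝟙 B, hφ, Category.comp_id φ, Or.inl ⟨rfl, inferInstance⟩⟩
  | comp φ₁ χ m hφ₁ hχ => exact ⟨_, φ₁, χ, hφ₁, rfl, Or.inr ⟨m, rfl, hχ⟩⟩

/-- An arrow of `P` out of `A` followed by an arbitrary arrow `f : X → B` that is an isomorphism
or a composite of FSMI-morphisms is a headed chain (of length `1`, resp. `m + 1`).
[cite: MochizukiFrdIComments2024, (28) p.3] -/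
theorem comp_of_isIso_or_chain (hP : ∀ {X Y Z : C} (f : X ⟶ Y) (e : Y ⟶ Z), IsIso e → P f → P (f ≫ e))
    {A X B : C} (φ₁ : A ⟶ X) (f : X ⟶ B) (hφ₁ : P φ₁) {m : ℕ}
    (hf : (m = 0 ∧ IsIso f) ∨ IsFSMIChain f m) : IsHeadedFSMIChain P (φ₁ ≫ f) (m + 1) := by
  rcases hf with ⟨rfl, hiso⟩ | hch
  · exact single _ (hP φ₁ f hiso hφ₁)
  · exact comp φ₁ f m hφ₁ hch

end IsHeadedFSMIChain

/-- A composite of `n` FSMI-morphisms is a headed chain of length `n` for the class of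
FSMI-morphisms (and hence for `⊤`). [cite: MochizukiFrdI2008, §0 p.17] -/
theorem IsFSMIChain.isHeadedFSMIChain {A B : C} {φ : A ⟶ B} {n : ℕ} (h : IsFSMIChain φ n) :
    IsHeadedFSMIChain (fun _ _ f => IsFSMI f) φ n := by
  cases h with
  | single φ hφ => exact IsHeadedFSMIChain.single φ hφ
  | cons ψ χ m hψ hχ => exact IsHeadedFSMIChain.comp ψ χ m hψ hχ

/-- Conversely, a headed chain for the class of FSMI-morphisms is a composite of FSMI-morphisms:
the 2008 chains are exactly the headed chains with FSMI head. [cite: MochizukiFrdI2008, §0 p.17] -/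
theorem isFSMIChain_iff_isHeadedFSMIChain {A B : C} (φ : A ⟶ B) (n : ℕ) :
    IsFSMIChain φ n ↔ IsHeadedFSMIChain (fun _ _ f => IsFSMI f) φ n := by
  refine ⟨IsFSMIChain.isHeadedFSMIChain, fun h => ?_⟩
  cases h with
  | single φ hφ => exact IsFSMIChain.single φ hφ
  | comp φ₁ χ m hφ₁ hχ => exact IsFSMIChain.cons φ₁ χ m hφ₁ hχ

/-! ### Categories of FSMFF-type, revised condition (b) -/

variable (C) in
/-- `C` is *of FSMFF-type* in the sense of the author's 2024 revision: (a) [as printed in 2008]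
every FSM-morphism that is not an isomorphism factors as a composite of finitely many
FSMI-morphisms; (b) [Comments (28)] "for every `A ∈ Ob(C)`, there exists a natural number `N`
such that for every composite `φₙ ∘ φₙ₋₁ ∘ ⋯ ∘ φ₂ ∘ φ₁` of some morphism `φ₁` whose domain is
equal to `A` with FSMI-morphisms `φ₂, …, φₙ`, it holds that `n ≤ N`." The printed 2008 condition
(b) (all of `φ₁, …, φₙ` FSMI) is the landed `IsOfFSMFFType`; see `IsOfFSMFFType2024.isOfFSMFFType`.
[cite: MochizukiFrdIComments2024, (28) p.3] -/
structure IsOfFSMFFType2024 : Prop where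
  /-- (a) finite factorisation of non-invertible FSM-morphisms into FSMI-morphisms (2008 = 2024) -/
  factors : ∀ {A B : C} (φ : A ⟶ B), IsFSM φ → ¬ IsIso φ → ∃ n, IsFSMIChain φ n
  /-- (b) [2024] bounded length of composites out of `A` with arbitrary head and FSMI tail -/
  bounded : ∀ A : C, ∃ N : ℕ, ∀ {B : C} (φ : A ⟶ B) (n : ℕ), IsHeadedFSMIChain ⊤ φ n → n ≤ N

namespace IsOfFSMFFType2024

/-- The revised notion implies the printed (2008) one: a chain of FSMI-morphisms out of `A` is in
particular a composite with arbitrary head and FSMI tail. [cite: MochizukiFrdIComments2024, (28) p.3] -/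
theorem isOfFSMFFType (hC : IsOfFSMFFType2024 C) : IsOfFSMFFType C where
  factors := hC.factors
  bounded A := by
    obtain ⟨N, hN⟩ := hC.bounded A
    exact ⟨N, fun φ n h => hN φ n h.isHeadedFSMIChain.top⟩

/-- The content of the revision: the bound at `A` controls, uniformly, the chains of
FSMI-morphisms out of every object `X` receiving an arrow `A → X` — a composite of `m`
FSMI-morphisms out of such an `X` has `m + 1 ≤ N_A`. [cite: MochizukiFrdIComments2024, (28) p.3] -/
theorem bounded_after (hC : IsOfFSMFFType2024 C) (A : C) :
    ∃ N : ℕ, ∀ {X B : C} (f : A ⟶ X) (χ : X ⟶ B) (m : ℕ), IsFSMIChain χ m → m + 1 ≤ N := by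
  obtain ⟨N, hN⟩ := hC.bounded A
  exact ⟨N, fun f χ m hχ => hN _ _ (IsHeadedFSMIChain.comp f χ m (MorphismProperty.top_apply f) hχ)⟩

/-- In particular [taking the head to be an identity] the 2008 bound at every object `X` under
`A` may be taken to be `N_A - 1`, uniformly in `X`. [cite: MochizukiFrdIComments2024, (28) p.3] -/
theorem bounded_uniform (hC : IsOfFSMFFType2024 C) (A : C) :
    ∃ N : ℕ, ∀ {X B : C}, Nonempty (A ⟶ X) → ∀ (χ : X ⟶ B) (m : ℕ), IsFSMIChain χ m → m ≤ N := by
  obtain ⟨N, hN⟩ := hC.bounded_after A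
  refine ⟨N - 1, fun ⟨f⟩ χ m hχ => ?_⟩
  have := hN f χ m hχ
  omega

/-- "We observe that [by condition (b)] no endomorphism of an object of a category of FSMFF-type
is an FSMI-morphism" (p. 18) — for the revised notion. [cite: MochizukiFrdI2008, §0 p.18] -/
theorem not_isFSMI_of_endomorphism (hC : IsOfFSMFFType2024 C) {A : C} (φ : A ⟶ A) : ¬ IsFSMI φ :=
  hC.isOfFSMFFType.not_isFSMI_of_endomorphism φ

end IsOfFSMFFType2024

/-- "Thus, if `C` is of FSM-type, then it is of FSMFF-type" (p. 18) survives the revision: a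
category of FSM-type has no FSMI-morphisms, so every composite as in (b) has length `1`.
[cite: MochizukiFrdI2008, §0 p.18] -/
theorem IsOfFSMType.isOfFSMFFType2024 (hC : IsOfFSMType C) : IsOfFSMFFType2024 C where
  factors φ hφ hφ' := (hφ' (hC.isIso_of_isFSM φ hφ)).elim
  bounded A := ⟨1, fun φ n h => by
    cases h with
    | single _ _ => exact le_rfl
    | comp φ₁ χ m _ hχ =>
      obtain ⟨X, ψ, hψ⟩ := hχ.exists_isFSMI
      exact (hC.not_isFSMI ψ hψ).elim⟩

/-- A headed chain with arbitrary head, read in a category of FSMFF-type (2024), has length at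
most the bound of (b) at its domain — restated with the bound chosen once and for all.
[cite: MochizukiFrdIComments2024, (28) p.3] -/
theorem IsOfFSMFFType2024.exists_bound (hC : IsOfFSMFFType2024 C) (A : C) :
    ∃ N : ℕ, 1 ≤ N ∧ ∀ {B : C} (φ : A ⟶ B) (n : ℕ), IsHeadedFSMIChain ⊤ φ n → n ≤ N := by
  obtain ⟨N, hN⟩ := hC.bounded A
  exact ⟨N, hN (𝟙 A) 1 (IsHeadedFSMIChain.single _ (MorphismProperty.top_apply _)), hN⟩

end Literature.AlgebraicGeometry.Frobenioids
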